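import Summits.HodgeConjecture.HodgeConjecture.Theorems.TropicalWeilObstructionTropicalWeilVanishingVariationalFamily
import HarnessLib

/-!
# Route `TropicalWeilObstruction` (Kontsevich's tropical test — NEGATION SINK, exploration, no summit claim):
# the VARIATIONAL direction bound — II. the class surface of the Weil family lies in the span of the frame squares

Negation-sink bookkeeping of the cell `pub-hodge-tropical` (seat tropical-1 gen 9); part II of the VARIATIONAL series. From part I
(`sum_frameSquares_lineFamily_eq`: along the realisation family of the type of an effective tropical `4`-cycle `Z` over a very
general Weil period `Q`, `cyc Z_t = a θ₄(Q+tD) + b Re w(Q+tD) + c Im w(Q+tD)` with constant integers for all small rational `t`)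
this file extracts the `t⁴`-coefficient:

* `polynomial_eq_zero_of_eval_ratCast_eq_zero`, `eval_det_X_smul_add`, `coeff_det_X_smul_add`, `ofReal_det_add_smul`,
  `conj_det_smul_add`, `submatrix_map_add_smul(_mul)` — determinant pencils `det(tA + B)` as polynomials (Mathlib's
  `Polynomial.coeff_det_X_add_C_card`); a complex polynomial with a neighbourhood of rational roots is zero;
* `weilFamilyClass_eq_sum_frameSquares` — **THE VARIATIONAL SPAN THEOREM**: for an effective tropical `4`-cycle `Z` on a very
  general p.p. tropical Weil eightfold with integer class coordinates `(a, b, c)` and EVERY integer symmetric `J`-commuting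
  matrix `D` (a direction of `Sym_J`, definite or not): `a θ₄(D) + b Re w(D) + c Im w(D) = Σ_σ c_σ · p_σ ⊗ p_σ` with real
  `c_σ` (`= w_σ det(T₁σ)/4!`) — the same integer combination of the theta and Weil class POLYNOMIALS, evaluated anywhere on the
  family, is a linear combination of the frame squares of the cells of `Z`;
* `weilFamilyClass_mem_span_frameSquares` — span form.

So `span_ℝ{p_σ ⊗ p_σ : σ a cell of Z} ⊇ V(a,b,c) := span{a θ₄(D) + b Re w(D) + c Im w(D) : D ∈ Sym_J(ℤ)}`. By the cell's
computation (kit job j181609, exact ranks over two prime fields; representation theory: the types (2,2), (2,1,1), (1⁴) of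
`GL₄ × GL₄` in `Sym⁴(V ⊗ V̄)`, `400 + 225 + 1`) `dim V(a,b,c) = 626` for every class with `a ≠ 0` (`10` at `n = 2`, `65` at
`n = 3`); part III gives the kernel form of the count with an abstract independence certificate. HONEST STATUS. A necessary
condition on counterexamples/seeds of an OPEN statement; nothing here decides K1 or bears on the Hodge conjecture. No definition,
no named fact, no sorry.

References: [Zharkov2020TropicalWeil] I. Zharkov, arXiv:2002.02347, §2 (pp. 2–4); [MikhalkinZharkov2014Eigenwave] G. Mikhalkin,
I. Zharkov, LN UMI 15 (2014), Def. 4.2, Prop. 4.3, Thm. 5.4.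
-/

set_option linter.dupNamespace false

noncomputable section

open scoped BigOperators Topology
open Matrix Filter
open Literature.AlgebraicGeometry.Tropical
open Summit.HodgeConjecture.HodgeConjecture.Theorems.TropicalHodgeBound

namespace Summit.HodgeConjecture.HodgeConjecture.Theorems.TropicalWeilVanishing.Variational

/-! ## §0 Display-only notation (the K3 skeleton's local definitions, verbatim bodies; nothing is defined) -/

/-- `P = [1 | i·1]`, the `n × 2n` matrix of `dz₁ ∧ … ∧ dz_n`. -/
local notation3 (prettyPrint := false) "𝐏⟦" n "⟧" =>
  (Matrix.of fun (k : Fin n) (a : Fin (2 * n)) =>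
    (if (a : ℕ) = (k : ℕ) then (1 : ℂ) else 0) + (if (a : ℕ) = (k : ℕ) + n then Complex.I else 0))

/-- The skeleton's `thetaClass n Q`. -/
local notation3 (prettyPrint := false) "θ⟦" n "⟧" Q:max =>
  (fun S S' : Fin n → Fin (2 * n) => Matrix.det (Matrix.submatrix Q S S'))

/-- The skeleton's `omegaFrame n` (`Ω = Pᴴ`). -/
local notation3 (prettyPrint := false) "Ω⟦" n "⟧" =>
  (Matrix.of fun (a : Fin (2 * n)) (b : Fin n) =>
    (if (a : ℕ) = (b : ℕ) then (1 : ℂ) else 0) - (if (a : ℕ) = (b : ℕ) + n then Complex.I else 0))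

/-- The skeleton's `weilClassC n Q` (`w(Q) = (⋀ⁿQ ⊗ 1)(Ω ⊗ Ω)`). -/
local notation3 (prettyPrint := false) "wC⟦" n "⟧" Q:max =>
  (fun S S' : Fin n → Fin (2 * n) =>
    Matrix.det (Matrix.submatrix (Matrix.map Q ((↑) : ℝ → ℂ) * Ω⟦n⟧) S id) *
      Matrix.det (Matrix.submatrix (Ω⟦n⟧) S' id))

/-- The skeleton's `weilClassRe n Q` (`w₁ = Re w`). -/
local notation3 (prettyPrint := false) "wRe⟦" n "⟧" Q:max =>
  (fun S S' : Fin n → Fin (2 * n) => Complex.re ((wC⟦n⟧ Q) S S'))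

/-- The skeleton's `weilClassIm n Q` (`w₂ = Im w`). -/
local notation3 (prettyPrint := false) "wIm⟦" n "⟧" Q:max =>
  (fun S S' : Fin n → Fin (2 * n) => Complex.im ((wC⟦n⟧ Q) S S'))

/-- The hermitian MASS `μ(Z) = Σ_σ w_σ a_σ |η_σ|²` of an effective tropical `n`-cycle. Nothing is defined. -/
local notation3 (prettyPrint := false) "μ⟦" n "," Z "⟧" =>
  (∑ σ, ((TropicalTorusCycle.cell Z σ).weight : ℝ) * (TropicalTorusCycle.cell Z σ).latticeVolume *
    ‖frameComplexDet n (TropicalTorusCycle.cell Z σ).frame‖ ^ 2)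

/-! ## §1 Polynomial tools -/

/-- There are infinitely many rationals in every neighbourhood of `0`, hence a complex polynomial vanishing at
(the images of) all rationals of a neighbourhood of `0 ∈ ℝ` is zero. [folklore] -/
theorem polynomial_eq_zero_of_eval_ratCast_eq_zero {S : Set ℝ} (hS : S ∈ 𝓝 (0 : ℝ)) (F : Polynomial ℂ)
    (hF : ∀ t : ℚ, (t : ℝ) ∈ S → F.eval ((t : ℝ) : ℂ) = 0) : F = 0 := by
  obtain ⟨ε, hε, hball⟩ := Metric.mem_nhds_iff.mp hS
  obtain ⟨q, hq0, hqε⟩ := exists_rat_btwn hε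
  -- the injective sequence `q / (k + 1)` of rationals in the ball
  let f : ℕ → ℂ := fun k => (((q / (k + 1) : ℚ) : ℝ) : ℂ)
  have hf_inj : Function.Injective f := by
    intro k l hkl
    have hq0' : (q : ℚ) ≠ 0 := by
      have : (0 : ℝ) < q := hq0
      exact_mod_cast this.ne'
    have h0 : (((q / (k + 1) : ℚ) : ℝ) : ℂ) = (((q / (l + 1) : ℚ) : ℝ) : ℂ) := hkl
    have h1 : ((q / (k + 1) : ℚ) : ℝ) = ((q / (l + 1) : ℚ) : ℝ) := Complex.ofReal_injective h0
    have h2 : (q / (k + 1) : ℚ) = q / (l + 1) := by exact_mod_cast h1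
    have hk : ((k : ℚ) + 1) ≠ 0 := by positivity
    have hl : ((l : ℚ) + 1) ≠ 0 := by positivity
    rw [div_eq_div_iff hk hl] at h2
    have h3 : ((l : ℚ) + 1) = (k : ℚ) + 1 := mul_left_cancel₀ hq0' h2
    have h4 : (l : ℚ) = k := by linarith
    exact_mod_cast h4.symm
  have hroots : ∀ k, F.IsRoot (f k) := by
    intro k
    apply hF
    apply hball
    rw [Metric.mem_ball, Real.dist_eq, sub_zero]
    have hk : (0 : ℝ) < (k : ℝ) + 1 := by positivity
    have hqR : (0 : ℝ) < q := hq0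
    push_cast
    rw [abs_of_pos (div_pos hqR hk)]
    calc (q : ℝ) / ((k : ℝ) + 1) ≤ q := div_le_self hqR.le (by linarith)
      _ < ε := hqε
  by_contra hne
  have hfin : Set.Finite {z : ℂ | F.IsRoot z} := Polynomial.finite_setOf_isRoot hne
  have hinf : Set.Infinite (Set.range f) := Set.infinite_range_of_injective hf_inj
  exact hinf (hfin.subset fun z ⟨k, hk⟩ => hk ▸ hroots k)

/-- The determinant pencil `det (X·A + B)` as a polynomial: evaluation. [folklore] -/
theorem eval_det_X_smul_add {m : ℕ} (A B : Matrix (Fin m) (Fin m) ℂ) (z : ℂ) :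
    (Matrix.det ((Polynomial.X : Polynomial ℂ) • A.map Polynomial.C + B.map Polynomial.C)).eval z =
      Matrix.det (z • A + B) := by
  have h := RingHom.map_det (Polynomial.evalRingHom z)
    ((Polynomial.X : Polynomial ℂ) • A.map Polynomial.C + B.map Polynomial.C)
  rw [Polynomial.coe_evalRingHom] at h
  rw [h]
  congr 1
  ext i j
  simp [Matrix.map_apply, Matrix.add_apply, Matrix.smul_apply]
  ring

/-- The determinant pencil `det (X·A + B)`: the coefficient of `X^m` is `det A`. [folklore] -/
theorem coeff_det_X_smul_add {m : ℕ} (A B : Matrix (Fin m) (Fin m) ℂ) :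
    (Matrix.det ((Polynomial.X : Polynomial ℂ) • A.map Polynomial.C + B.map Polynomial.C)).coeff m = Matrix.det A := by
  have h := Polynomial.coeff_det_X_add_C_card A B
  rwa [Fintype.card_fin] at h


variable (Q : Matrix (Fin (2 * 4)) (Fin (2 * 4)) ℝ)

/-! ## §4 Polynomial extraction: the class surface of the whole Weil family lies in the span of the frame squares -/

/-- `det` commutes with the real-to-complex cast along a pencil. [folklore] -/
theorem ofReal_det_add_smul {m : ℕ} (N M : Matrix (Fin m) (Fin m) ℝ) (t : ℝ) :
    ((((N + t • M).det : ℝ)) : ℂ) =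
      Matrix.det (((t : ℝ) : ℂ) • M.map ((↑) : ℝ → ℂ) + N.map ((↑) : ℝ → ℂ)) := by
  have h := RingHom.map_det Complex.ofRealHom (N + t • M)
  rw [Complex.ofRealHom_eq_coe] at h
  rw [h]
  congr 1
  ext i j
  simp [Matrix.add_apply, Matrix.smul_apply, Matrix.map_apply]
  ring

/-- Complex conjugation commutes with `det` along a real pencil. [folklore] -/
theorem conj_det_smul_add {m : ℕ} (A B : Matrix (Fin m) (Fin m) ℂ) (t : ℝ) :
    (starRingEnd ℂ) (Matrix.det (((t : ℝ) : ℂ) • B + A)) =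
      Matrix.det (((t : ℝ) : ℂ) • B.map (starRingEnd ℂ) + A.map (starRingEnd ℂ)) := by
  rw [RingHom.map_det]
  congr 1
  ext i j
  simp [Matrix.add_apply, Matrix.smul_apply, Matrix.map_apply, Complex.conj_ofReal]

/-- `b Re u + c Im u = β u + β̄ ū` with `β = (b - ci)/2`. [folklore] -/
theorem ofReal_re_im_combination (b c : ℝ) (u : ℂ) :
    (((b * u.re + c * u.im : ℝ)) : ℂ) =
      ((b : ℂ) - (c : ℂ) * Complex.I) / 2 * u + ((b : ℂ) + (c : ℂ) * Complex.I) / 2 * (starRingEnd ℂ) u := by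
  apply Complex.ext
  · simp; ring
  · simp; ring

/-- The `S`-rows of `(Q + tD)_ℂ Ω` along the pencil. [folklore] -/
theorem submatrix_map_add_smul_mul (Q D : Matrix (Fin (2 * 4)) (Fin (2 * 4)) ℝ) (t : ℝ) (S : Fin 4 → Fin (2 * 4))
    (Ω : Matrix (Fin (2 * 4)) (Fin 4) ℂ) :
    ((t : ℝ) : ℂ) • Matrix.submatrix (Matrix.map D ((↑) : ℝ → ℂ) * Ω) S id +
        Matrix.submatrix (Matrix.map Q ((↑) : ℝ → ℂ) * Ω) S id =
      Matrix.submatrix (Matrix.map (Q + t • D) ((↑) : ℝ → ℂ) * Ω) S id := by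
  ext i j
  simp only [Matrix.add_apply, Matrix.smul_apply, Matrix.submatrix_apply, Matrix.mul_apply, Matrix.map_apply,
    id, smul_eq_mul, Complex.ofReal_add, Complex.ofReal_mul, Finset.mul_sum, ← Finset.sum_add_distrib]
  refine Finset.sum_congr rfl fun k _ => ?_
  ring

/-- The `(S,S')`-minor along the pencil. [folklore] -/
theorem submatrix_map_add_smul (Q D : Matrix (Fin (2 * 4)) (Fin (2 * 4)) ℝ) (t : ℝ) (S S' : Fin 4 → Fin (2 * 4)) :
    ((t : ℝ) : ℂ) • (Matrix.submatrix D S S').map ((↑) : ℝ → ℂ) + (Matrix.submatrix Q S S').map ((↑) : ℝ → ℂ) =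
      (Matrix.submatrix (Q + t • D) S S').map ((↑) : ℝ → ℂ) := by
  ext i j
  simp [Matrix.add_apply, Matrix.smul_apply, Matrix.submatrix_apply, Matrix.map_apply]
  ring

/-- **THE VARIATIONAL SPAN THEOREM.** Let `Z` be an effective tropical `4`-cycle on a very general principally polarised
tropical Weil eightfold `ℝ⁸/Qℤ⁸` with integer class coordinates `cyc Z = a θ₄(Q) + b Re w(Q) + c Im w(Q)` (p345948), and
let `D` be ANY integer symmetric `J`-commuting matrix (a direction of the tropical Weil family `Sym_J`, definite or not).
Then the class `a θ₄(D) + b Re w(D) + c Im w(D)` — the same integer combination of the theta and Weil class POLYNOMIALS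
evaluated at `D` — is a real linear combination of the frame squares `p_σ ⊗ p_σ` of the cells of `Z`:
`a θ₄(D) + b Re w(D) + c Im w(D) = Σ_σ c_σ · p_σ ⊗ p_σ`, indeed with `c_σ = w_σ det(T₁σ)/4!` for the linear part `T₁` of
the realisation family of the type of `Z` along `Q + tD`. (Mechanism: the type of `Z` realises along the line with the
SAME integer class for all small rational `t` (`cyc_lineCycle_eq`); `t ↦ cyc Z_t − (aθ₄ + bRe w + cIm w)(Q+tD)` is a
polynomial of degree `≤ 4` in `t` with infinitely many zeros; its `t⁴`-coefficient is the stated identity.) Hence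
`span_ℝ{p_σ ⊗ p_σ} ⊇ V(a,b,c) := span{a θ₄(D) + b Re w(D) + c Im w(D) : D ∈ Sym_J(ℤ)}`, a space of dimension `626`
(seat computation, kit job j181609; representation theory: `400 + 225 + 1`), so `Z` has cells in at least `626` pairwise
distinct rational `4`-planes. Nothing here decides K1 or bears on HC.
[cite: Zharkov2020TropicalWeil, §2 (pp. 2–4)] [cite: MikhalkinZharkov2014Eigenwave, Prop. 4.3 and Thm. 5.4] -/
theorem weilFamilyClass_eq_sum_frameSquares (hQ : Q.PosDef) (hJ : Q * weilJ 4 = weilJ 4 * Q)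
    (hgen : IsWeilGeneric 4 Q) (Z : TropicalTorusCycle (2 * 4) 4 Q) {a b c : ℤ}
    (hq : Z.cyc = (a : ℝ) • θ⟦4⟧ Q + (b : ℝ) • wRe⟦4⟧ Q + (c : ℝ) • wIm⟦4⟧ Q)
    (D : Matrix (Fin (2 * 4)) (Fin (2 * 4)) ℤ) (hDS : (D.map ((↑) : ℤ → ℝ)).IsSymm)
    (hDJr : D.map ((↑) : ℤ → ℝ) * weilJ 4 = weilJ 4 * D.map ((↑) : ℤ → ℝ)) :
    ∃ coef : Fin Z.numCells → ℝ,
      (a : ℝ) • θ⟦4⟧ (D.map ((↑) : ℤ → ℝ)) + (b : ℝ) • wRe⟦4⟧ (D.map ((↑) : ℤ → ℝ)) +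
          (c : ℝ) • wIm⟦4⟧ (D.map ((↑) : ℤ → ℝ)) =
        ∑ σ, coef σ • fun S S' : Fin 4 → Fin (2 * 4) =>
          ((pluckerCoord (Z.cell σ).frame S : ℤ) : ℝ) * ((pluckerCoord (Z.cell σ).frame S' : ℤ) : ℝ) := by
  set Dr : Matrix (Fin (2 * 4)) (Fin (2 * 4)) ℝ := D.map ((↑) : ℤ → ℝ) with hDr
  obtain ⟨V₀, V₁, T₁, R₀, R₁, hfam⟩ := exists_lineFamily Q hQ hJ hgen Z Dr hDS hDJr
  obtain ⟨S₀, hS₀, hconst⟩ := sum_frameSquares_lineFamily_eq Q hQ hJ hgen Z hq D hDS hDJr V₀ V₁ T₁ R₀ R₁ hfam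
  refine ⟨fun σ => ((Z.cell σ).weight : ℝ) * ((T₁ σ).det / (Nat.factorial 4 : ℝ)), ?_⟩
  funext S S'
  -- abbreviations
  set E : Fin Z.numCells → Matrix (Fin 4) (Fin 4) ℝ := fun σ => (Z.cell σ).edgeCoeff with hE
  set pp : Fin Z.numCells → ℝ := fun σ =>
    ((pluckerCoord (Z.cell σ).frame S : ℤ) : ℝ) * ((pluckerCoord (Z.cell σ).frame S' : ℤ) : ℝ) with hpp
  set k : Fin Z.numCells → ℝ := fun σ => ((Z.cell σ).weight : ℝ) * pp σ / (Nat.factorial 4 : ℝ) with hk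
  set AS : Matrix (Fin 4) (Fin 4) ℂ := Matrix.submatrix (Matrix.map Q ((↑) : ℝ → ℂ) * Ω⟦4⟧) S id with hAS
  set BS : Matrix (Fin 4) (Fin 4) ℂ := Matrix.submatrix (Matrix.map Dr ((↑) : ℝ → ℂ) * Ω⟦4⟧) S id with hBS
  set ω' : ℂ := Matrix.det (Matrix.submatrix (Ω⟦4⟧) S' id) with hω'
  set β : ℂ := ((b : ℂ) - (c : ℂ) * Complex.I) / 2 with hβ
  set β' : ℂ := ((b : ℂ) + (c : ℂ) * Complex.I) / 2 with hβ'
  -- the polynomial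
  let pencil : Matrix (Fin 4) (Fin 4) ℂ → Matrix (Fin 4) (Fin 4) ℂ → Polynomial ℂ := fun A B =>
    Matrix.det ((Polynomial.X : Polynomial ℂ) • A.map Polynomial.C + B.map Polynomial.C)
  let F : Polynomial ℂ :=
    ∑ σ, Polynomial.C ((k σ : ℝ) : ℂ) * pencil ((T₁ σ).map ((↑) : ℝ → ℂ)) ((E σ).map ((↑) : ℝ → ℂ))
      - Polynomial.C (a : ℂ) * pencil ((Matrix.submatrix Dr S S').map ((↑) : ℝ → ℂ))
          ((Matrix.submatrix Q S S').map ((↑) : ℝ → ℂ))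
      - Polynomial.C (β * ω') * pencil BS AS
      - Polynomial.C (β' * (starRingEnd ℂ) ω') * pencil (BS.map (starRingEnd ℂ)) (AS.map (starRingEnd ℂ))
  have heval : ∀ z : ℂ, F.eval z =
      ∑ σ, ((k σ : ℝ) : ℂ) * Matrix.det (z • (T₁ σ).map ((↑) : ℝ → ℂ) + (E σ).map ((↑) : ℝ → ℂ))
        - (a : ℂ) * Matrix.det (z • (Matrix.submatrix Dr S S').map ((↑) : ℝ → ℂ) +
            (Matrix.submatrix Q S S').map ((↑) : ℝ → ℂ))
        - β * ω' * Matrix.det (z • BS + AS)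
        - β' * (starRingEnd ℂ) ω' * Matrix.det (z • BS.map (starRingEnd ℂ) + AS.map (starRingEnd ℂ)) := by
    intro z
    simp only [F, pencil, Polynomial.eval_sub, Polynomial.eval_finsetSum, Polynomial.eval_mul, Polynomial.eval_C,
      eval_det_X_smul_add]
  -- `F` vanishes at every rational parameter of `S₀`
  have hroot : ∀ t : ℚ, (t : ℝ) ∈ S₀ → F.eval ((t : ℝ) : ℂ) = 0 := by
    intro t ht
    obtain ⟨-, hcyc⟩ := hconst t ht
    have hSS := congrFun (congrFun hcyc S) S'
    have hL : (∑ σ, ((Z.cell σ).weight : ℝ) * (((Z.cell σ).edgeCoeff + (t : ℝ) • T₁ σ).det / (Nat.factorial 4 : ℝ)) *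
        ((pluckerCoord (Z.cell σ).frame S : ℤ) : ℝ) * ((pluckerCoord (Z.cell σ).frame S' : ℤ) : ℝ)) =
        ∑ σ, k σ * (E σ + (t : ℝ) • T₁ σ).det := by
      refine Finset.sum_congr rfl fun σ _ => ?_
      simp only [hk, hpp, hE]
      ring
    simp only [] at hSS
    rw [hL] at hSS
    simp only [Pi.add_apply, Pi.smul_apply, smul_eq_mul] at hSS
    rw [heval]
    have h1 : ∀ σ, Matrix.det (((t : ℝ) : ℂ) • (T₁ σ).map ((↑) : ℝ → ℂ) + (E σ).map ((↑) : ℝ → ℂ)) =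
        ((((E σ + (t : ℝ) • T₁ σ).det : ℝ)) : ℂ) := fun σ => (ofReal_det_add_smul (E σ) (T₁ σ) t).symm
    have h2 : Matrix.det (((t : ℝ) : ℂ) • (Matrix.submatrix Dr S S').map ((↑) : ℝ → ℂ) +
        (Matrix.submatrix Q S S').map ((↑) : ℝ → ℂ)) =
        (((Matrix.det (Matrix.submatrix (Q + (t : ℝ) • Dr) S S') : ℝ)) : ℂ) := by
      rw [submatrix_map_add_smul]
      have h := RingHom.map_det Complex.ofRealHom (Matrix.submatrix (Q + (t : ℝ) • Dr) S S')
      rw [Complex.ofRealHom_eq_coe] at h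
      rw [h]
      rfl
    have h3 : ((t : ℝ) : ℂ) • BS + AS = Matrix.submatrix (Matrix.map (Q + (t : ℝ) • Dr) ((↑) : ℝ → ℂ) * Ω⟦4⟧) S id :=
      submatrix_map_add_smul_mul Q Dr t S _
    have h4 : Matrix.det (((t : ℝ) : ℂ) • BS.map (starRingEnd ℂ) + AS.map (starRingEnd ℂ)) =
        (starRingEnd ℂ) (Matrix.det (((t : ℝ) : ℂ) • BS + AS)) := (conj_det_smul_add AS BS t).symm
    simp only [h1, h2, h4, h3]
    set u : ℂ := Matrix.det (Matrix.submatrix (Matrix.map (Q + (t : ℝ) • Dr) ((↑) : ℝ → ℂ) * Ω⟦4⟧) S id) with hu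
    have key : (((∑ σ, k σ * (E σ + (t : ℝ) • T₁ σ).det : ℝ)) : ℂ) =
        ((a : ℝ) : ℂ) * (((Matrix.det (Matrix.submatrix (Q + (t : ℝ) • Dr) S S') : ℝ)) : ℂ) +
          ((((b : ℝ) * (u * ω').re + (c : ℝ) * (u * ω').im : ℝ)) : ℂ) := by
      rw [hSS]; push_cast; ring
    rw [ofReal_re_im_combination, map_mul] at key
    push_cast at key
    rw [hβ, hβ']
    linear_combination key
  have hF : F = 0 := polynomial_eq_zero_of_eval_ratCast_eq_zero hS₀ F hroot
  -- read off the coefficient of `t⁴`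
  have hc := congrArg (fun p : Polynomial ℂ => p.coeff 4) hF
  simp only [F, pencil, Polynomial.coeff_sub, Polynomial.finsetSum_coeff, Polynomial.coeff_C_mul,
    coeff_det_X_smul_add, Polynomial.coeff_zero] at hc
  -- interpret the four leading coefficients
  have i1 : ∀ σ, Matrix.det ((T₁ σ).map ((↑) : ℝ → ℂ)) = (((T₁ σ).det : ℝ) : ℂ) := by
    intro σ
    have h := RingHom.map_det Complex.ofRealHom (T₁ σ)
    rw [Complex.ofRealHom_eq_coe] at h
    exact h.symm
  have i2 : Matrix.det ((Matrix.submatrix Dr S S').map ((↑) : ℝ → ℂ)) =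
      (((Matrix.det (Matrix.submatrix Dr S S')) : ℝ) : ℂ) := by
    have h := RingHom.map_det Complex.ofRealHom (Matrix.submatrix Dr S S')
    rw [Complex.ofRealHom_eq_coe] at h
    exact h.symm
  have i4 : Matrix.det (BS.map (starRingEnd ℂ)) = (starRingEnd ℂ) (Matrix.det BS) := (RingHom.map_det _ _).symm
  rw [i2, i4] at hc
  simp only [i1] at hc
  -- the real identity at `(S, S')`
  simp only [Finset.sum_apply, Pi.add_apply, Pi.smul_apply, smul_eq_mul]
  rw [show (∑ x, ((Z.cell x).weight : ℝ) * ((T₁ x).det / (Nat.factorial 4 : ℝ)) *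
      (((pluckerCoord (Z.cell x).frame S : ℤ) : ℝ) * ((pluckerCoord (Z.cell x).frame S' : ℤ) : ℝ))) =
      ∑ x, k x * (T₁ x).det from Finset.sum_congr rfl fun x _ => by simp only [hk, hpp]; ring]
  apply Complex.ofReal_injective
  have hv : (wC⟦4⟧ Dr) S S' = Matrix.det BS * ω' := rfl
  have key2 := ofReal_re_im_combination (b : ℝ) (c : ℝ) ((wC⟦4⟧ Dr) S S')
  rw [hv, map_mul] at key2
  push_cast at key2 ⊢
  rw [hβ, hβ'] at hc
  linear_combination key2 - hc


end Summit.HodgeConjecture.HodgeConjecture.Theorems.TropicalWeilVanishing.Variational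

end
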